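import Literature.Geometry.GeometricMeasureTheory.CurrentsEuclideanCycle
import Mathlib.MeasureTheory.Integral.Prod
import Mathlib.MeasureTheory.Integral.IntervalIntegral.FundThmCalculus
import HarnessLib

/-!
# The slab current `⟦0,1⟧ × 𝐄ⁿ` and its boundary

On the product `ℝ × P` of the line with a finite-dimensional real normed space `P` carrying an
additive Haar measure `μ`, the **slab current** of a constant `n`-frame `e` of `P` is the
`(n+1)`-current

`𝐒(φ) = ∫_{[0,1]} ∫_P φ(t, x)((1,0), (0,e₁), …, (0,eₙ)) dμ(x) dt`

(`slabCurrent`, a `vectorCurrent` of `Currents.lean` on any open `Ω ⊆ ℝ × P`, for the measure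
`(vol ⌞ [0,1]) × μ`). Its boundary is "top minus bottom" — Federer's homotopy formula
`∂(⟦0,1⟧ × T) = δ₁ × T − δ₀ × T − ⟦0,1⟧ × ∂T` (4.1.8) for `T = 𝐄ⁿ ∧ e`, `∂𝐄ⁿ = 0`:

* `slabCurrent_boundary_apply` :
  `∂𝐒(ψ) = ∫_P ψ(1, x)((0,e₁), …, (0,eₙ)) dμ − ∫_P ψ(0, x)((0,e₁), …, (0,eₙ)) dμ`.

The proof expands `dψ(v₀, …, vₙ) = Σᵢ (-1)ⁱ D_{vᵢ}(ψ(v̂ᵢ))` (Mathlib's `extDeriv_apply`): the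
`i = 0` term is a `t`-derivative, integrated by the fundamental theorem of calculus on `[0,1]`,
and the `i ≥ 1` terms are `x`-derivatives of compactly supported functions on `P`, whose
integrals vanish (`integral_fderiv_apply_eq_zero` of `CurrentsEuclideanCycle.lean`, Fubini).

## References

* H. Federer, *Geometric Measure Theory*, Springer 1969, 4.1.8 (cartesian products and
  homotopies: `∂(⟦a,b⟧ × T)`), 4.1.7 (`∂𝐄ⁿ = 0`) [Federer1969].
-/

noncomputable section

open scoped Topology ENNReal
open MeasureTheory TopologicalSpace Set Filter

namespace Literature.Geometry.GeometricMeasureTheory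

-- Nested operator-norm instances on (duals of) `E [⋀^Fin m]→L[ℝ] ℝ`.
set_option maxSynthPendingDepth 2

section Frame

variable {P : Type*} [AddCommGroup P] {n : ℕ}

/-- The constant `(n+1)`-frame `((1,0), (0,e₁), …, (0,eₙ))` of `ℝ × P`. [cite: Federer1969, 4.1.8] -/
def slabFrame (e : Fin n → P) : Fin (n + 1) → ℝ × P :=
  Fin.cons ((1 : ℝ), (0 : P)) fun j => ((0 : ℝ), e j)

/-- `v₀ = (1, 0)`. [folklore] -/
@[simp] theorem slabFrame_zero (e : Fin n → P) : slabFrame e 0 = ((1 : ℝ), (0 : P)) := by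
  simp [slabFrame]

/-- `v_{j+1} = (0, eⱼ)`. [folklore] -/
@[simp] theorem slabFrame_succ (e : Fin n → P) (j : Fin n) :
    slabFrame e j.succ = ((0 : ℝ), e j) := by
  simp [slabFrame]

/-- The tail of the slab frame is `((0,e₁), …, (0,eₙ))`. [folklore] -/
theorem tail_slabFrame (e : Fin n → P) : Fin.tail (slabFrame e) = fun j => ((0 : ℝ), e j) := by
  funext j
  simp [Fin.tail, slabFrame]

end Frame

/-! ### Slices of compactly supported functions on `ℝ × P` -/

section Slices

variable {P : Type*} [TopologicalSpace P] [R1Space P] {G : Type*} [Zero G]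

/-- A slice `x ↦ g (t, x)` of a compactly supported function has compact support. [folklore] -/
theorem hasCompactSupport_slice_right {g : ℝ × P → G} (hg : HasCompactSupport g) (t : ℝ) :
    HasCompactSupport fun x => g (t, x) := by
  refine HasCompactSupport.intro (hg.image continuous_snd) fun x hx => ?_
  exact image_eq_zero_of_notMem_tsupport fun h => hx ⟨(t, x), h, rfl⟩

omit [R1Space P] in
/-- A slice `t ↦ g (t, x)` of a compactly supported function has compact support. [folklore] -/
theorem hasCompactSupport_slice_left {g : ℝ × P → G} (hg : HasCompactSupport g) (x : P) :
    HasCompactSupport fun t => g (t, x) := by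
  refine HasCompactSupport.intro (hg.image continuous_fst) fun t ht => ?_
  exact image_eq_zero_of_notMem_tsupport fun h => ht ⟨(t, x), h, rfl⟩

end Slices

variable {P : Type*} [NormedAddCommGroup P] [NormedSpace ℝ P] [FiniteDimensional ℝ P]
  [MeasurableSpace P] [BorelSpace P] (μ : Measure P) [μ.IsAddHaarMeasure] {n : ℕ}

/-- **The slab current** `⟦0,1⟧ × (μ ∧ e)` on an open `Ω ⊆ ℝ × P`:
`𝐒(φ) = ∫ φ(v) d((vol ⌞ [0,1]) × μ)`, `v = slabFrame e`. [cite: Federer1969, 4.1.8] -/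
def slabCurrent (Ω : Opens (ℝ × P)) (e : Fin n → P) : Current Ω (n + 1) :=
  vectorCurrent (((volume : Measure ℝ).restrict (Icc 0 1)).prod μ)
    fun _ => frameVector (slabFrame e)

/-- `𝐒(φ) = ∫ φ(z)(v) d((vol ⌞ [0,1]) × μ)(z)`. [cite: Federer1969, 4.1.8] -/
theorem slabCurrent_apply (Ω : Opens (ℝ × P)) (e : Fin n → P) (φ : TestForm Ω (n + 1)) :
    slabCurrent μ Ω e φ =
      ∫ z, φ z (slabFrame e) ∂(((volume : Measure ℝ).restrict (Icc 0 1)).prod μ) := by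
  rw [slabCurrent, vectorCurrent_apply (locallyIntegrableOn_const _)]
  simp [frameVector_apply]

/-- `𝐒(φ) = ∫_{t ∈ [0,1]} ∫_P φ(t,x)(v) dμ dt`. [cite: Federer1969, 4.1.8] -/
theorem slabCurrent_apply' (Ω : Opens (ℝ × P)) (e : Fin n → P) (φ : TestForm Ω (n + 1)) :
    slabCurrent μ Ω e φ = ∫ t in Icc (0 : ℝ) 1, ∫ x, φ (t, x) (slabFrame e) ∂μ := by
  rw [slabCurrent_apply, integral_prod]
  refine Integrable.mono_measure ?_ (Measure.prod_mono Measure.restrict_le_self le_rfl)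
  refine Continuous.integrable_of_hasCompactSupport ?_ ?_
  · exact (ContinuousAlternatingMap.apply ℝ (ℝ × P) ℝ (slabFrame e)).continuous.comp φ.continuous
  · exact φ.hasCompactSupport.mono fun z hz h0 => hz (by simp [h0])

/-! ### The boundary of the slab current -/

set_option maxHeartbeats 1600000 in
/-- **`∂(⟦0,1⟧ × 𝐄ⁿ) = δ₁ × 𝐄ⁿ − δ₀ × 𝐄ⁿ`**: for every test `n`-form `ψ` on an open
`Ω ⊆ ℝ × P`,
`∂𝐒(ψ) = ∫_P ψ(1,x)((0,e₁),…,(0,eₙ)) dμ − ∫_P ψ(0,x)((0,e₁),…,(0,eₙ)) dμ`.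
[cite: Federer1969, 4.1.8] -/
theorem slabCurrent_boundary_apply (Ω : Opens (ℝ × P)) (e : Fin n → P) (ψ : TestForm Ω n) :
    (slabCurrent μ Ω e).boundary ψ =
      (∫ x, ψ ((1 : ℝ), x) (fun j => ((0 : ℝ), e j)) ∂μ) -
        ∫ x, ψ ((0 : ℝ), x) (fun j => ((0 : ℝ), e j)) ∂μ := by
  set v := slabFrame e with hv
  set ν : Measure (ℝ × P) := ((volume : Measure ℝ).restrict (Icc 0 1)).prod μ with hν
  have hψd : ContDiff ℝ 1 (ψ : ℝ × P → Covector (ℝ × P) n) :=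
    ψ.contDiff.of_le (by exact_mod_cast le_top)
  have hdiff : ∀ z, DifferentiableAt ℝ (ψ : ℝ × P → Covector (ℝ × P) n) z := fun z =>
    (hψd.differentiable one_ne_zero).differentiableAt
  have hψs : HasCompactSupport (ψ : ℝ × P → Covector (ℝ × P) n) := ψ.hasCompactSupport
  rw [Current.boundary_apply, slabCurrent_apply]
  simp_rw [TestForm.extDerivCLM_apply]
  -- expand `dψ(v) = Σᵢ (-1)ⁱ D_{vᵢ}(ψ(v̂ᵢ))`, signs read in `ℝ`
  simp_rw [extDeriv_apply (hdiff _), ← Int.cast_smul_eq_zsmul ℝ, Int.cast_pow, Int.cast_neg,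
    Int.cast_one]
  -- the scalar slices `y ↦ ψ y (v̂ᵢ)` are `C¹` with compact support
  have hterm : ∀ i : Fin (n + 1),
      ContDiff ℝ 1 (fun y => (ψ : ℝ × P → Covector (ℝ × P) n) y (i.removeNth v)) ∧
        HasCompactSupport (fun y => (ψ : ℝ × P → Covector (ℝ × P) n) y (i.removeNth v)) :=
    fun i => ⟨(ContinuousAlternatingMap.apply ℝ (ℝ × P) ℝ (i.removeNth v)).contDiff.comp hψd,
      hψs.mono fun y hy h0 => hy (by simp [h0])⟩
  set F : Fin (n + 1) → ℝ × P → ℝ := fun i z => ((-1 : ℝ) ^ (i : ℕ)) •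
    fderiv ℝ (fun y => (ψ : ℝ × P → Covector (ℝ × P) n) y (i.removeNth v)) z (v i) with hF
  have hFc : ∀ i, Continuous (F i) := fun i => by
    have h : Continuous fun z : ℝ × P =>
        fderiv ℝ (fun y => (ψ : ℝ × P → Covector (ℝ × P) n) y (i.removeNth v)) z (v i) :=
      ((hterm i).1.continuous_fderiv one_ne_zero).clm_apply continuous_const
    exact h.const_smul ((-1 : ℝ) ^ (i : ℕ))
  have hFs : ∀ i, HasCompactSupport (F i) := fun i => by
    have h : HasCompactSupport fun z : ℝ × P =>
        fderiv ℝ (fun y => (ψ : ℝ × P → Covector (ℝ × P) n) y (i.removeNth v)) z (v i) :=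
      (hterm i).2.fderiv_apply (𝕜 := ℝ) (v i)
    refine h.mono fun z hz => ?_
    intro h0
    refine hz ?_
    show ((-1 : ℝ) ^ (i : ℕ)) • fderiv ℝ
      (fun y => (ψ : ℝ × P → Covector (ℝ × P) n) y (i.removeNth v)) z (v i) = 0
    have h0' : fderiv ℝ (fun y => (ψ : ℝ × P → Covector (ℝ × P) n) y (i.removeNth v)) z (v i)
        = 0 := h0
    rw [h0', smul_zero]
  have hFi' : ∀ i, Integrable (F i) ((volume : Measure ℝ).prod μ) := fun i =>
    (hFc i).integrable_of_hasCompactSupport (hFs i)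
  have hνle : ν ≤ (volume : Measure ℝ).prod μ := Measure.prod_mono Measure.restrict_le_self le_rfl
  have hFi : ∀ i, Integrable (F i) ν := fun i => (hFi' i).mono_measure hνle
  change ∫ z, ∑ i, F i z ∂ν = _
  rw [integral_finsetSum Finset.univ fun i _ => hFi i, Fin.sum_univ_succ]
  -- the `x`-derivative terms vanish
  have hzero : ∀ j : Fin n, ∫ z, F j.succ z ∂ν = 0 := by
    intro j
    rw [hν, integral_prod _ (hFi j.succ)]
    refine integral_eq_zero_of_ae (Eventually.of_forall fun t => ?_)
    simp only [hF, hv, slabFrame_succ, Pi.zero_apply]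
    rw [integral_smul]
    set w := j.succ.removeNth (slabFrame e)
    have hg : ContDiff ℝ 1 fun x : P => (ψ : ℝ × P → Covector (ℝ × P) n) (t, x) w :=
      (hterm j.succ).1.comp (contDiff_const.prodMk contDiff_id)
    have hgs : HasCompactSupport fun x : P => (ψ : ℝ × P → Covector (ℝ × P) n) (t, x) w :=
      hasCompactSupport_slice_right (hterm j.succ).2 t
    have key := integral_fderiv_apply_eq_zero (μ := μ) hg hgs (e j)
    have hchain : ∀ x : P,
        fderiv ℝ (fun x : P => (ψ : ℝ × P → Covector (ℝ × P) n) (t, x) w) x (e j) =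
          fderiv ℝ (fun y => (ψ : ℝ × P → Covector (ℝ × P) n) y w) (t, x) ((0 : ℝ), e j) := by
      intro x
      have h1 : HasFDerivAt (fun x : P => ((t, x) : ℝ × P))
          ((0 : P →L[ℝ] ℝ).prod (ContinuousLinearMap.id ℝ P)) x :=
        (hasFDerivAt_const t x).prodMk (hasFDerivAt_id x)
      have h2 : HasFDerivAt (fun x : P => (ψ : ℝ × P → Covector (ℝ × P) n) (t, x) w)
          ((fderiv ℝ (fun y => (ψ : ℝ × P → Covector (ℝ × P) n) y w) (t, x)).comp
            ((0 : P →L[ℝ] ℝ).prod (ContinuousLinearMap.id ℝ P))) x :=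
        (((hterm j.succ).1.differentiable one_ne_zero).differentiableAt
          (x := (t, x))).hasFDerivAt.comp x h1
      rw [h2.fderiv]
      simp
    simp_rw [hchain] at key
    rw [key, smul_zero]
  simp only [hzero, Finset.sum_const_zero, add_zero]
  -- the `t`-derivative term: Fubini with `x` outside, FTC inside
  rw [hν, integral_prod_symm _ (hFi 0)]
  have h0c : Continuous fun y => (ψ : ℝ × P → Covector (ℝ × P) n) y fun j => ((0 : ℝ), e j) :=
    (ContinuousAlternatingMap.apply ℝ (ℝ × P) ℝ fun j => ((0 : ℝ), e j)).continuous.comp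
      ψ.continuous
  have h0s : HasCompactSupport fun y => (ψ : ℝ × P → Covector (ℝ × P) n) y
      fun j => ((0 : ℝ), e j) := by
    have := (hterm 0).2
    rwa [Fin.removeNth_zero, hv, tail_slabFrame] at this
  have hint1 : Integrable (fun x => (ψ : ℝ × P → Covector (ℝ × P) n) ((1 : ℝ), x)
      fun j => ((0 : ℝ), e j)) μ :=
    (h0c.comp (continuous_const.prodMk continuous_id)).integrable_of_hasCompactSupport
      (hasCompactSupport_slice_right h0s 1)
  have hint0 : Integrable (fun x => (ψ : ℝ × P → Covector (ℝ × P) n) ((0 : ℝ), x)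
      fun j => ((0 : ℝ), e j)) μ :=
    (h0c.comp (continuous_const.prodMk continuous_id)).integrable_of_hasCompactSupport
      (hasCompactSupport_slice_right h0s 0)
  rw [← integral_sub hint1 hint0]
  refine integral_congr_ae (Eventually.of_forall fun x => ?_)
  simp only [hF, Fin.val_zero, pow_zero, one_smul, Fin.removeNth_zero, hv, tail_slabFrame,
    slabFrame_zero]
  -- FTC on `[0,1]` for `t ↦ ψ (t, x) (tail v)`
  set g : ℝ × P → ℝ := fun y => (ψ : ℝ × P → Covector (ℝ × P) n) y fun j => ((0 : ℝ), e j)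
    with hg
  have hgd : ContDiff ℝ 1 g := by
    have := (hterm 0).1
    rwa [Fin.removeNth_zero, hv, tail_slabFrame] at this
  have hder : ∀ t, HasDerivAt (fun t : ℝ => g (t, x)) (fderiv ℝ g (t, x) ((1 : ℝ), (0 : P))) t := by
    intro t
    have h1 : HasDerivAt (fun t : ℝ => ((t, x) : ℝ × P)) ((1 : ℝ), (0 : P)) t :=
      (hasDerivAt_id t).prodMk (hasDerivAt_const t x)
    exact ((hgd.differentiable one_ne_zero).differentiableAt.hasFDerivAt).comp_hasDerivAt t h1
  have hcont : Continuous fun t : ℝ => fderiv ℝ g (t, x) ((1 : ℝ), (0 : P)) :=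
    ((hgd.continuous_fderiv one_ne_zero).comp (continuous_id.prodMk continuous_const)).clm_apply
      continuous_const
  rw [integral_Icc_eq_integral_Ioc, ← intervalIntegral.integral_of_le zero_le_one,
    intervalIntegral.integral_eq_sub_of_hasDerivAt (fun t _ => hder t)
      (hcont.intervalIntegrable 0 1)]

end Literature.Geometry.GeometricMeasureTheory
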